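import Summits.NavierStokesRegularity.NavierStokesRegularity.Theorems.ScaledTopAlignmentFlexibleZoom
import Summits.NavierStokesRegularity.NavierStokesRegularity.Theorems.ScaledTopAlignmentMostTimesWindowAt
import Summits.NavierStokesRegularity.NavierStokesRegularity.Theorems.LocalSineTubeDoorProfileAlignedWindowRigidity
import Summits.NavierStokesRegularity.NavierStokesRegularity.Theorems.SymmetryModuliCountLiouvilleKillsTypeI
import Summits.NavierStokesRegularity.NavierStokesRegularity.Theorems.IsobarTomographyTubeAlternativeStubTwoSidedVorticityRate
import Summits.NavierStokesRegularity.NavierStokesRegularity.Theses.TypeILiouville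
import Literature.Analysis.FluidPDE.VorticityCalculus
import HarnessLib
/-!
# Route `ScaledTopAlignment`: GLUE KIT for the SEQUENCE door — the near-maximum window-bulk clause demanded
# only ALONG SOME SEQUENCE OF TIMES `t_j → T` (chosen per solution and per parameter), the weakest member of
# the window-door family (support for the deciding crux W3ᵐᵗ = `AprioriMostTimesBulkAlignment`,
# stmt-NavierStokesRegularity-19551, and its weakenings; no import of the route file)

Planner p3 (STATUS 2026-08-26T10:48Z, ROUND-8 candidate T-8.1 «SEQUENCE DOOR») asked whether a door that holds
only along SOME sequence of times — the analogue of Seregin's `lim`-not-`limsup` necessary condition — still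
glues. It does, and without any nesting/dilation-invariance: for all `κ, q, ε, δ > 0` the door supplies a
level `M` and times `t_j ∈ [0,T)`, `t_j → T`, at which the window-bulk bound holds at every point that is
rate-near-maximal (`κ/(T−t_j) ≤ |ω|`), relatively near-maximal (`q|ω(t_j,x′)| ≤ |ω(t_j,x)|` for all `x′`) and
above the level `M`. Proof (`false_of_seqNearMaxBulkAligned_typeI`):
1. DIAGONAL BASE TIMES. Along the levels `κ_n = q_n = ε_n = δ_n = 1/(n+1)` the door gives `M_n` and sequences
   `t^{(n)}`; pick `τ_n := t^{(n)}_{i(n)}` so close to `T` that `(T − τ_n)(M_n + 1) ≤ 1/(n+1)`.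
2. FLEXIBLE ZOOM AT THE CALLER'S TIMES (`typeIZoom_ancientMild_limit_flexible`, conclusion (i)): a non-trivial
   Type-I ancient mild limit `W` whose slice `−1` vorticity is the limit of the vorticity zooms read EXACTLY at
   the times `τ_{φ(j)}`.
3. BACKWARD UNIQUENESS (tree, `TubeAlternative.AnalyticPropagation.slice_eq_zero_of_curl_slice_eq_zero`):
   `curl W(−1) ≢ 0` since `W(−1, 0) ≠ 0` — the single slice `−1` suffices, no end, no slice selection.
4. At the preimages of a point `y₀` with `curl W(−1) y₀ ≠ 0`: `|ω| ≍ ν|curl W(−1)y₀|/λ_j²`, so the levels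
   `M_{φ(j)}` (with `M_{φ(j)} λ_j² → 0`), the rate premise (`κ_{φ(j)} → 0`) and the relative premise
   (`q_{φ(j)} → 0`, upper Type-I vorticity law `upper_vorticity_rate`) are all eventually satisfied, and the
   door is monotone in `(ε, δ)`; the window lemma read at the preimages
   (`exists_window_cross_eq_zero_of_windowBulkAligned_at`) aligns `curl W(−1)` near `y₀`, and
   LocalSineTubeDoor's `eq_zero_of_aligned_window` forces `W ≡ 0` — contradiction.
Bridge `navierStokesRegularity_of_seqNearMaxBulkAlignment_of_noTypeII`. Every earlier door of the route (W3ʷᵇ,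
W3ᵐᵗ 19551, the near-maximum and scale-sequence variants) implies this one (a set of final density `< 1`
misses points arbitrarily close to `T`). WHAT THIS IS NOT: not NS regularity; nothing here proves any door;
NoTypeII stays the residual hard core. References: Giga–Miura, CMP 303 (2011) = HUPS #956, Thm 1.1, Rmk 1.4,
§2.1 [GigaMiura2011]; KNSS, Acta Math. 203 (2009), Prop. 4.1, §6, Remark 6.1 [KochNadirashviliSereginSverak2009];
Seregin, CMP 312 (2012) 833–845 (the `lim` criterion, as motivation) [Seregin2012].
-/

noncomputable section
-- the summit and its single sub-problem share the name (CONVENTIONS §1), as in every Theorems file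
set_option linter.dupNamespace false
open MeasureTheory Set Function Filter Topology Metric
open scoped RealInnerProductSpace ENNReal
namespace Summit.NavierStokesRegularity.NavierStokesRegularity.Theorems
open Literature.Analysis Literature.Analysis.FluidPDE
open Summit.NavierStokesRegularity.NavierStokesRegularity.Theorems.LocalSineTubeDoorProfileAlignedWindowRigidity
open Summit.NavierStokesRegularity.NavierStokesRegularity.Theorems.TubeAlternative.AnalyticPropagation

set_option maxHeartbeats 800000 in
/-- **A sequence door kills Type-I blow-up.** Let `(u, p)` be a classical solution on `ℝ³ × [0, T)`,
Leray–Hopf from its rapidly decaying datum, bounded on every `[0, T'] × ℝ³` (`T' < T`), with the Type-I rate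
at `T` and no smooth extension past `T`. Suppose that for some `λ₀ < 1`, `R₀ > 0` and all `κ, q, ε, δ > 0`
there are a level `M` and times `t_j ∈ [0, T)`, `t_j → T`, such that at every `t_j` and every `x` with
`|ω(t_j,x)| ≥ M`, `≥ κ/(T − t_j)` and `≥ q·|ω(t_j,x′)|` for all `x′`, the `ε`-misaligned part of the relative
`λ₀`-top set in the window of radius `R₀ℓ` has volume `≤ δ ℓ³`. Then `False`.
[cite: GigaMiura2011, Thm 1.1 with Rmk 1.4 and §2.1 (HUPS preprint #956 pp. 3–9)] -/
theorem false_of_seqNearMaxBulkAligned_typeI {ν T : ℝ} (hν : 0 < ν) (hT : 0 < T)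
    {u : ℝ → EuclideanSpace ℝ (Fin 3) → EuclideanSpace ℝ (Fin 3)} {p : ℝ → EuclideanSpace ℝ (Fin 3) → ℝ}
    (hsol : IsClassicalNSSolutionOn (Ico 0 T) ν 0 u p) (hLH : IsLerayHopfOn T ν 0 (u 0) u)
    (hdec : HasRapidSpatialDecay (u 0))
    (hslab : ∀ T' < T, ∃ M : ℝ, ∀ t ∈ Icc 0 T', ∀ x, ‖u t x‖ ≤ M)
    (hI : IsTypeIBlowup u T) (hext : ¬ HasSmoothExtensionPast ν 0 u T)
    {lam0 R0 : ℝ} (hlam01 : lam0 < 1) (hR0 : 0 < R0)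
    (hW : ∀ κ : ℝ, 0 < κ → ∀ q : ℝ, 0 < q → ∀ ε : ℝ, 0 < ε → ∀ δ : ℝ, 0 < δ → ∃ M : ℝ, 0 < M ∧
      ∃ ts : ℕ → ℝ, (∀ j, ts j ∈ Set.Ico 0 T) ∧ Tendsto ts atTop (𝓝 T) ∧
      ∀ (j : ℕ) (x : EuclideanSpace ℝ (Fin 3)), M ≤ ‖curl (u (ts j)) x‖ →
        κ / (T - ts j) ≤ ‖curl (u (ts j)) x‖ →
        (∀ x' : EuclideanSpace ℝ (Fin 3), q * ‖curl (u (ts j)) x'‖ ≤ ‖curl (u (ts j)) x‖) →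
          volume {y : EuclideanSpace ℝ (Fin 3) | lam0 * ‖curl (u (ts j)) x‖ ≤ ‖curl (u (ts j)) y‖ ∧
              ‖x - y‖ ≤ R0 * Real.sqrt (ν / ‖curl (u (ts j)) x‖) ∧
              ε < Real.sqrt (1 - (inner ℝ (‖curl (u (ts j)) x‖⁻¹ • curl (u (ts j)) x)
                (‖curl (u (ts j)) y‖⁻¹ • curl (u (ts j)) y)) ^ 2)}
            ≤ ENNReal.ofReal (δ * Real.sqrt (ν / ‖curl (u (ts j)) x‖) ^ 3)) : False := by
  -- Step 1: the levels `1/(n+1)` and the diagonal base times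
  have hlev : ∀ n : ℕ, ∃ M : ℝ, 0 < M ∧ ∃ ts : ℕ → ℝ, (∀ j, ts j ∈ Set.Ico 0 T) ∧
      Tendsto ts atTop (𝓝 T) ∧ ∀ (j : ℕ) (x : EuclideanSpace ℝ (Fin 3)), M ≤ ‖curl (u (ts j)) x‖ →
        1 / ((n : ℝ) + 1) / (T - ts j) ≤ ‖curl (u (ts j)) x‖ →
        (∀ x' : EuclideanSpace ℝ (Fin 3), 1 / ((n : ℝ) + 1) * ‖curl (u (ts j)) x'‖ ≤ ‖curl (u (ts j)) x‖) →
          volume {y : EuclideanSpace ℝ (Fin 3) | lam0 * ‖curl (u (ts j)) x‖ ≤ ‖curl (u (ts j)) y‖ ∧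
              ‖x - y‖ ≤ R0 * Real.sqrt (ν / ‖curl (u (ts j)) x‖) ∧
              1 / ((n : ℝ) + 1) < Real.sqrt (1 - (inner ℝ (‖curl (u (ts j)) x‖⁻¹ • curl (u (ts j)) x)
                (‖curl (u (ts j)) y‖⁻¹ • curl (u (ts j)) y)) ^ 2)}
            ≤ ENNReal.ofReal (1 / ((n : ℝ) + 1) * Real.sqrt (ν / ‖curl (u (ts j)) x‖) ^ 3) :=
    fun n => hW _ (by positivity) _ (by positivity) _ (by positivity) _ (by positivity)
  choose M hM0 ts hts htsT hgood using hlev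
  -- the diagonal index: `(T - ts n i) (M n + 1) ≤ 1/(n+1)`
  have hdiag : ∀ n : ℕ, ∃ i : ℕ, (T - ts n i) * (M n + 1) ≤ 1 / ((n : ℝ) + 1) := by
    intro n
    have h1 : Tendsto (fun i => (T - ts n i) * (M n + 1)) atTop (𝓝 ((T - T) * (M n + 1))) :=
      ((htsT n).const_sub T).mul_const _
    rw [sub_self, zero_mul] at h1
    exact (h1.eventually (Iic_mem_nhds (by positivity))).exists
  choose ι hι using hdiag
  set τ : ℕ → ℝ := fun n => ts n (ι n) with hτdef
  have hτ : ∀ n, τ n ∈ Ico 0 T := fun n => hts n (ι n)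
  have hTτ : ∀ n, T - τ n ≤ 1 / ((n : ℝ) + 1) := fun n => by
    have h1 : T - τ n ≤ (T - τ n) * (M n + 1) := by
      have := sub_pos.2 (hτ n).2
      nlinarith [hM0 n]
    exact h1.trans (hι n)
  have hτT : Tendsto τ atTop (𝓝 T) := by
    have h0 : Tendsto (fun n => T - τ n) atTop (𝓝 0) :=
      squeeze_zero (fun n => (sub_pos.2 (hτ n).2).le) hTτ
        (tendsto_one_div_add_atTop_nhds_zero_nat (𝕜 := ℝ))
    have h := h0.const_sub T
    rw [sub_zero] at h
    exact h.congr fun n => by ring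
  -- Step 2: the flexible zoom at the diagonal base times; slice `-1` is read at `τ (φ j)`
  obtain ⟨φ, hφ, C, W, xc, lam, hWcl, hW0, hlam, hlam2, -, hconv1, -⟩ :=
    typeIZoom_ancientMild_limit_flexible hν hT hsol hLH hslab hI hext hτ hτT
  -- Step 3: backward uniqueness — the slice `-1` vorticity is somewhere non-zero
  set Ω : EuclideanSpace ℝ (Fin 3) → EuclideanSpace ℝ (Fin 3) := curl (W (-1)) with hΩdef
  obtain ⟨y₀, hy₀⟩ : ∃ y₀, Ω y₀ ≠ 0 := by
    by_contra h
    push Not at h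
    exact hW0 (slice_eq_zero_of_curl_slice_eq_zero hWcl (by norm_num) h 0)
  set A : ℝ := ‖Ω y₀‖ with hAdef
  have hA : 0 < A := norm_pos_iff.2 hy₀
  have hΩc : Continuous Ω :=
    continuous_curl ((hWcl.contDiff_slice (by norm_num : (-1 : ℝ) < 0)).of_le (by exact_mod_cast le_top))
  -- the upper Type-I law for the vorticity near `T`
  obtain ⟨Cω, tω, htω, hCω⟩ := upper_vorticity_rate hν hT hsol hLH hdec hI
  set C' : ℝ := max Cω 1 with hC'def
  have hC' : 0 < C' := lt_of_lt_of_le one_pos (le_max_right _ _)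
  have hCω' : ∀ t ∈ Ico tω T, ∀ x, ‖curl (u t) x‖ ≤ C' / (T - t) := fun t ht x =>
    (hCω t ht x).trans (div_le_div_of_nonneg_right (le_max_left _ _) (sub_pos.2 ht.2).le)
  -- Step 4: the window lemma read at the preimages of `y₀`, levels `M (φ j)`
  have hφt : Tendsto φ atTop atTop := hφ.tendsto_atTop
  have hlev0 : Tendsto (fun j => 1 / ((φ j : ℝ) + 1)) atTop (𝓝 0) :=
    (tendsto_one_div_add_atTop_nhds_zero_nat (𝕜 := ℝ)).comp hφt
  have hμ : ∀ j, 0 < lam j ^ 2 / ν := fun j => div_pos (pow_pos (hlam j) 2) hν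
  have hμeq : ∀ j, lam j ^ 2 / ν = T - τ (φ j) := fun j => by rw [hlam2 j]; field_simp
  have hbig : ∀ᶠ j in atTop, A / 2 < ‖(lam j ^ 2 / ν) • curl (u (τ (φ j))) (xc j + lam j • y₀)‖ :=
    (hconv1 y₀).norm.eventually_const_lt (by linarith)
  have hlate : ∀ᶠ j in atTop, tω < τ (φ j) := (hτT.comp hφt).eventually_const_lt htω.2
  have hWseq : ∀ ε : ℝ, 0 < ε → ∀ δ : ℝ, 0 < δ → ∃ Ms : ℕ → ℝ,
      Tendsto (fun j => Ms j * lam j ^ 2) atTop (𝓝 0) ∧ ∀ᶠ j in atTop,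
      Ms j ≤ ‖curl (u (τ (φ j))) (xc j + lam j • y₀)‖ →
        volume {y : EuclideanSpace ℝ (Fin 3) |
            lam0 * ‖curl (u (τ (φ j))) (xc j + lam j • y₀)‖ ≤ ‖curl (u (τ (φ j))) y‖ ∧
            ‖(xc j + lam j • y₀) - y‖ ≤ R0 * Real.sqrt (ν / ‖curl (u (τ (φ j))) (xc j + lam j • y₀)‖) ∧
            ε < Real.sqrt (1 - (inner ℝ
              (‖curl (u (τ (φ j))) (xc j + lam j • y₀)‖⁻¹ • curl (u (τ (φ j))) (xc j + lam j • y₀))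
              (‖curl (u (τ (φ j))) y‖⁻¹ • curl (u (τ (φ j))) y)) ^ 2)}
          ≤ ENNReal.ofReal (δ * Real.sqrt (ν / ‖curl (u (τ (φ j))) (xc j + lam j • y₀)‖) ^ 3) := by
    intro ε hε δ hδ
    refine ⟨fun j => M (φ j), ?_, ?_⟩
    · -- `M (φ j) λ_j² = ν M (φ j) (T - τ (φ j)) ≤ ν/(φ j + 1) → 0`
      have hb : ∀ j, M (φ j) * lam j ^ 2 ≤ ν * (1 / ((φ j : ℝ) + 1)) := fun j => by
        have e : M (φ j) * lam j ^ 2 = ν * ((T - τ (φ j)) * M (φ j)) := by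
          rw [hlam2 j]; ring
        rw [e]
        refine mul_le_mul_of_nonneg_left ?_ hν.le
        have h1 : (T - τ (φ j)) * M (φ j) ≤ (T - τ (φ j)) * (M (φ j) + 1) :=
          mul_le_mul_of_nonneg_left (by linarith) (sub_pos.2 (hτ _).2).le
        exact h1.trans (hι (φ j))
      have h0 : Tendsto (fun j => ν * (1 / ((φ j : ℝ) + 1))) atTop (𝓝 (ν * 0)) := hlev0.const_mul ν
      rw [mul_zero] at h0
      exact squeeze_zero (fun j => (mul_pos (hM0 _) (pow_pos (hlam j) 2)).le) hb h0
    · have hA4 : (0 : ℝ) < A / (4 * C') := by positivity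
      filter_upwards [hlev0.eventually (Iic_mem_nhds hε), hlev0.eventually (Iic_mem_nhds hδ),
        hlev0.eventually (Iio_mem_nhds (half_pos hA)), hlev0.eventually (Iio_mem_nhds hA4), hbig, hlate]
        with j hjε hjδ hjA hjq hjb hjl hMx
      set tt : ℝ := τ (φ j) with htt
      set Pt : EuclideanSpace ℝ (Fin 3) := xc j + lam j • y₀ with hPt
      have hTt : 0 < T - tt := sub_pos.2 (hτ _).2
      -- `A/2 < |ω(tt, Pt)| (T - tt)`
      have hωT : A / 2 < ‖curl (u tt) Pt‖ * (T - tt) := by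
        have h1 := hjb
        rw [norm_smul, Real.norm_of_nonneg (hμ j).le, hμeq j] at h1
        linarith [h1]
      have hκ : 1 / ((φ j : ℝ) + 1) / (T - tt) ≤ ‖curl (u tt) Pt‖ := by
        rw [div_le_iff₀ hTt]
        have : 1 / ((φ j : ℝ) + 1) < A / 2 := hjA
        linarith
      have hq : ∀ x' : EuclideanSpace ℝ (Fin 3),
          1 / ((φ j : ℝ) + 1) * ‖curl (u tt) x'‖ ≤ ‖curl (u tt) Pt‖ := by
        intro x'
        have h1 : ‖curl (u tt) x'‖ ≤ C' / (T - tt) := hCω' tt ⟨hjl.le, (hτ _).2⟩ x'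
        have h2 : 1 / ((φ j : ℝ) + 1) * (C' / (T - tt)) ≤ A / 2 / (T - tt) := by
          rw [mul_div_assoc', div_le_div_iff_of_pos_right hTt]
          have : 1 / ((φ j : ℝ) + 1) < A / (4 * C') := hjq
          have h3 : 1 / ((φ j : ℝ) + 1) * C' < A / (4 * C') * C' := mul_lt_mul_of_pos_right this hC'
          have h4 : A / (4 * C') * C' = A / 4 := by field_simp
          linarith [h3, h4]
        calc 1 / ((φ j : ℝ) + 1) * ‖curl (u tt) x'‖
            ≤ 1 / ((φ j : ℝ) + 1) * (C' / (T - tt)) := mul_le_mul_of_nonneg_left h1 (by positivity)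
          _ ≤ A / 2 / (T - tt) := h2
          _ ≤ ‖curl (u tt) Pt‖ := by rw [div_le_iff₀ hTt]; exact hωT.le
      have hbnd := hgood (φ j) (ι (φ j)) Pt hMx hκ hq
      refine le_trans (measure_mono fun y hy => ?_) (le_trans hbnd (ENNReal.ofReal_le_ofReal ?_))
      · obtain ⟨h1, h2, h3⟩ := hy
        exact ⟨h1, h2, lt_of_le_of_lt hjε h3⟩
      · exact mul_le_mul_of_nonneg_right hjδ (pow_nonneg (Real.sqrt_nonneg _) 3)
  obtain ⟨U, hUo, hy₀U, hal⟩ := exists_window_cross_eq_zero_of_windowBulkAligned_at hν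
    (ω := fun t => curl (u t)) (t := fun j => τ (φ j)) (xc := xc) (lam := lam) hlam01 hR0 hlam
    hWseq hΩc hconv1 hy₀
  exact hW0 (eq_zero_of_aligned_window hWcl.hasTypeITimeDecay hWcl.continuousOn_uncurry
    (fun s t hst ht' x => hWcl.mild_eq_heatExtension hst ht' x) (fun t ht' => hWcl.isDivFree ht')
    (by norm_num : (-1 : ℝ) < 0) hy₀ hUo ⟨y₀, hy₀U⟩ hal (-1) (by norm_num) 0)

/-- **Bridge: the SEQUENCE door plus NoTypeII gives Clay (A).** Door (per solution: `λ₀ < 1`, `R₀ > 0`;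
then for all `κ, q, ε, δ > 0` a level `M` and times `t_j ∈ [0,T)`, `t_j → T`, at which the window-bulk
bound holds at every rate- and relatively-near-maximal point above the level). With NoTypeII:
`NavierStokesRegularity` (through `TypeILiouville.Assembly_holds`, the slab bound
`liouvilleKillsTypeI_exists_bound_Icc` and `false_of_seqNearMaxBulkAligned_typeI`).
[cite: GigaMiura2011, Thm 1.1 with Rmk 1.4 and §2.1] -/
theorem navierStokesRegularity_of_seqNearMaxBulkAlignment_of_noTypeII
    (hW : ∀ (ν T : ℝ), 0 < ν → 0 < T → ∀ (u : ℝ → EuclideanSpace ℝ (Fin 3) → EuclideanSpace ℝ (Fin 3))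
      (p : ℝ → EuclideanSpace ℝ (Fin 3) → ℝ), IsClassicalNSSolutionOn (Set.Ico 0 T) ν 0 u p →
      IsLerayHopfOn T ν 0 (u 0) u → HasRapidSpatialDecay (u 0) →
      ∃ lam0 : ℝ, lam0 < 1 ∧ ∃ R0 : ℝ, 0 < R0 ∧ ∀ κ : ℝ, 0 < κ → ∀ q : ℝ, 0 < q →
        ∀ ε : ℝ, 0 < ε → ∀ δ : ℝ, 0 < δ → ∃ M : ℝ, 0 < M ∧ ∃ ts : ℕ → ℝ, (∀ j, ts j ∈ Set.Ico 0 T) ∧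
        Filter.Tendsto ts Filter.atTop (nhds T) ∧
        ∀ (j : ℕ) (x : EuclideanSpace ℝ (Fin 3)), M ≤ ‖curl (u (ts j)) x‖ →
          κ / (T - ts j) ≤ ‖curl (u (ts j)) x‖ →
          (∀ x' : EuclideanSpace ℝ (Fin 3), q * ‖curl (u (ts j)) x'‖ ≤ ‖curl (u (ts j)) x‖) →
            MeasureTheory.volume {y : EuclideanSpace ℝ (Fin 3) |
                lam0 * ‖curl (u (ts j)) x‖ ≤ ‖curl (u (ts j)) y‖ ∧
                ‖x - y‖ ≤ R0 * Real.sqrt (ν / ‖curl (u (ts j)) x‖) ∧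
                ε < Real.sqrt (1 - (inner ℝ (‖curl (u (ts j)) x‖⁻¹ • curl (u (ts j)) x)
                  (‖curl (u (ts j)) y‖⁻¹ • curl (u (ts j)) y)) ^ 2)}
              ≤ ENNReal.ofReal (δ * Real.sqrt (ν / ‖curl (u (ts j)) x‖) ^ 3))
    (hII : ∀ (ν T : ℝ), 0 < ν → 0 < T → ∀ (u : ℝ → EuclideanSpace ℝ (Fin 3) → EuclideanSpace ℝ (Fin 3))
      (p : ℝ → EuclideanSpace ℝ (Fin 3) → ℝ), IsMaximalSmoothSolution ν 0 u p T →
      IsLerayHopfOn T ν 0 (u 0) u → HasRapidSpatialDecay (u 0) → IsTypeIBlowup u T) :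
    NavierStokesRegularity := by
  apply Summit.NavierStokesRegularity.NavierStokesRegularity.Theses.TypeILiouville.Assembly_holds
  intro ν T hν hT u p hcl hLH hdec
  by_contra hext
  have hI : IsTypeIBlowup u T := hII ν T hν hT u p ⟨hcl, hext⟩ hLH hdec
  have hbdd : ∀ T' < T, ∃ M : ℝ, ∀ s ∈ Set.Icc 0 T', ∀ x, ‖u s x‖ ≤ M := by
    intro T' hT'
    by_cases h : 0 < T'
    · exact liouvilleKillsTypeI_exists_bound_Icc hν hcl hLH hdec ⟨h, hT'⟩
    · obtain ⟨M, hM⟩ := liouvilleKillsTypeI_exists_bound_Icc hν hcl hLH hdec (T' := T / 2)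
        ⟨by linarith, by linarith⟩
      push Not at h
      exact ⟨M, fun s hs x => hM s ⟨hs.1, by linarith [hs.2]⟩ x⟩
  obtain ⟨lam0, hlam01, R0, hR0, hfam⟩ := hW ν T hν hT u p hcl hLH hdec
  exact false_of_seqNearMaxBulkAligned_typeI hν hT hcl hLH hdec hbdd hI hext hlam01 hR0 hfam
end Summit.NavierStokesRegularity.NavierStokesRegularity.Theorems
end
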